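import Literature.NumberTheory.DiophantineGeometry.Conductor
import Literature.NumberTheory.DiophantineGeometry.TateAlgorithmProofs
import Literature.NumberTheory.DiophantineGeometry.TateAlgorithmLocal
import Literature.NumberTheory.DiophantineGeometry.TateAlgorithmOrdDiscriminant
import Literature.NumberTheory.DiophantineGeometry.ConductorExponentLeTwoProofs
import HarnessLib

/-!
# The conductor is tame in residue characteristic `≠ 2, 3` (discharge)

Discharge of the named fact `WeierstrassCurve.conductorExponent_eq_tameConductorExponent` of
`Literature.NumberTheory.DiophantineGeometry.Conductor`: for an elliptic `W / K` and a finite place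
`v` of residue characteristic `≠ 2, 3`, `f_v = ε_v`, where `f_v = W.conductorExponent v` is
defined by Ogg's formula `ord_v (Δ_min) + 1 − m_v` and `ε_v ∈ {0, 1, 2}` is the tame exponent
read off from the Kodaira symbol (Silverman ATAEC IV.10.2(b): for `p ≥ 5`, `δ = 0` and
`f = 0, 1, 2` for good, multiplicative, additive reduction; IV.11.1, proof for `p ≥ 5`, PDF p. 366:
good reduction `v(𝒟) = 0, m = 1`; multiplicative `m = v(𝒟)` by Step 2 of Tate's algorithm;
additive `v(𝒟) = m + 1` "case-by-case, checking each of the reduction types II, III, …, II*"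
using Table 4.1).

## Proof architecture

* `WeierstrassCurve.conductorExponent_eq_tameConductorExponent_of` reduces the fact to
  `WeierstrassCurve.ordMinimalDiscriminant_eq_numComponentsAt_add_one v W` (Table 4.1's row
  `v(Δ) = m + 1` for additive reduction in residue characteristic `≠ 2, 3`): the good and
  multiplicative cases are Steps 1–2 of Tate's algorithm on the integral local minimal model
  (`kodairaSymbolOfMinimal_eq_I_iff`), and in the additive case the computed symbol is of additive
  type — the junk `I₀` of Step 11 would force `π³ ∣ Δ` in residue characteristic `≠ 2, 3`
  (`Literature.NumberTheory.DiophantineGeometry.TateAlgorithm.Δ_mem_maximalIdeal_pow_three_of_kodairaSymbolOfMinimal_eq_I_zero`).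
* `WeierstrassCurve.conductorExponent_eq_tameConductorExponent_holds` then feeds in the discharge
  `WeierstrassCurve.ordMinimalDiscriminant_eq_numComponentsAt_add_one_holds`
  (`TateAlgorithmOrdDiscriminant`), i.e. the DVR theorem
  `Literature.NumberTheory.DiophantineGeometry.TateAlgorithm.addVal_Δ_toNat_eq_numComponents_add_one` (`TateAlgorithmLocal`) applied to the
  integral local minimal model over `O_v` (minimality excludes Step 11 by
  `Literature.NumberTheory.DiophantineGeometry.TateAlgorithm.not_isMinimal_of_pow_dvd`; `2, 3 ∈ O_vˣ` is the residue-characteristic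
  assumption).

## References

* J. H. Silverman, *Advanced Topics in the Arithmetic of Elliptic Curves* (ATAEC), GTM 151, 1994,
  IV.9.4 and Table 4.1 (Tate's algorithm), Thm IV.10.2 (PDF p. 358), Thm IV.10.4 (PDF p. 362),
  Ogg's formula IV.11.1 and its proof for `p ≥ 5` (PDF pp. 365–366).
-/

open Polynomial IsDedekindDomain

namespace Literature.NumberTheory.DiophantineGeometry

namespace TateAlgorithm

section DVR

variable {R : Type*} [CommRing R] [IsDomain R] [IsDiscreteValuationRing R]

/-- `𝔪ᵃ · 𝔪ᵇ ⊆ 𝔪ᵃ⁺ᵇ` on elements. [folklore] -/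
theorem mul_mem_maximalIdeal_pow_add {a b : ℕ} {r s : R}
    (hr : r ∈ IsLocalRing.maximalIdeal R ^ a) (hs : s ∈ IsLocalRing.maximalIdeal R ^ b) :
    r * s ∈ IsLocalRing.maximalIdeal R ^ (a + b) := by
  rw [pow_add]
  exact Ideal.mul_mem_mul hr hs

/-- **Step 3 failing forces `π³ ∣ Δ`.** If `π ∣ b₂`, `π ∣ a₃`, `π ∣ a₄` and `π² ∣ a₆` (the
situation after the step-2 translation of Tate's algorithm when the tests of steps 2 and 3 both
fail), then `π ∣ b₄`, `π² ∣ b₆`, `π² ∣ b₈`, hence `π³ ∣ Δ = -b₂² b₈ - 8 b₄³ - 27 b₆² + 9 b₂ b₄ b₆`.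
Silverman ATAEC IV.9.4, steps 3–4 (p. 344: "`π² ∣ a₆` … implies `π² ∣ b₆` and `π² ∣ b₈`").
[cite: Silverman1994, IV.9.4 steps 3–4] -/
theorem Δ_mem_maximalIdeal_pow_three {V : WeierstrassCurve R}
    (hb₂ : V.b₂ ∈ IsLocalRing.maximalIdeal R) (h3 : V.a₃ ∈ IsLocalRing.maximalIdeal R)
    (h4 : V.a₄ ∈ IsLocalRing.maximalIdeal R) (h6 : V.a₆ ∈ IsLocalRing.maximalIdeal R ^ 2) :
    V.Δ ∈ IsLocalRing.maximalIdeal R ^ 3 := by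
  have h1 : IsLocalRing.maximalIdeal R = IsLocalRing.maximalIdeal R ^ 1 := (pow_one _).symm
  have hb₂' : V.b₂ ∈ IsLocalRing.maximalIdeal R ^ 1 := h1 ▸ hb₂
  have h3' : V.a₃ ∈ IsLocalRing.maximalIdeal R ^ 1 := h1 ▸ h3
  have h4' : V.a₄ ∈ IsLocalRing.maximalIdeal R ^ 1 := h1 ▸ h4
  have hb₄ : V.b₄ ∈ IsLocalRing.maximalIdeal R ^ 1 := by
    rw [WeierstrassCurve.b₄]
    exact Ideal.add_mem _ (Ideal.mul_mem_left _ _ h4') (Ideal.mul_mem_left _ _ h3')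
  have hb₆ : V.b₆ ∈ IsLocalRing.maximalIdeal R ^ 2 := by
    rw [WeierstrassCurve.b₆, pow_two V.a₃]
    exact Ideal.add_mem _ (mul_mem_maximalIdeal_pow_add h3' h3') (Ideal.mul_mem_left _ _ h6)
  have hb₈ : V.b₈ ∈ IsLocalRing.maximalIdeal R ^ 2 := by
    rw [WeierstrassCurve.b₈]
    refine Ideal.sub_mem _ (Ideal.add_mem _ (Ideal.sub_mem _ (Ideal.add_mem _ ?_ ?_) ?_) ?_) ?_
    · exact Ideal.mul_mem_left _ _ h6
    · exact Ideal.mul_mem_left _ _ h6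
    · rw [mul_assoc]
      exact Ideal.mul_mem_left _ _ (mul_mem_maximalIdeal_pow_add h3' h4')
    · rw [pow_two V.a₃]
      exact Ideal.mul_mem_left _ _ (mul_mem_maximalIdeal_pow_add h3' h3')
    · rw [pow_two V.a₄]
      exact mul_mem_maximalIdeal_pow_add h4' h4'
  have h43 : IsLocalRing.maximalIdeal R ^ 4 ≤ IsLocalRing.maximalIdeal R ^ 3 :=
    Ideal.pow_le_pow_right (by norm_num)
  rw [WeierstrassCurve.Δ]
  refine Ideal.add_mem _ (Ideal.sub_mem _ (Ideal.sub_mem _ ?_ ?_) ?_) ?_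
  · rw [neg_mul]
    refine (Ideal.neg_mem_iff _).mpr (h43 ?_)
    rw [pow_two V.b₂]
    exact mul_mem_maximalIdeal_pow_add (mul_mem_maximalIdeal_pow_add hb₂' hb₂') hb₈
  · rw [show V.b₄ ^ 3 = V.b₄ * V.b₄ * V.b₄ by ring]
    exact Ideal.mul_mem_left _ _
      (mul_mem_maximalIdeal_pow_add (mul_mem_maximalIdeal_pow_add hb₄ hb₄) hb₄)
  · refine Ideal.mul_mem_left _ _ (h43 ?_)
    rw [pow_two V.b₆]
    exact mul_mem_maximalIdeal_pow_add hb₆ hb₆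
  · refine h43 ?_
    rw [mul_assoc (9 : R), mul_assoc (9 : R)]
    refine Ideal.mul_mem_left _ _ ?_
    exact mul_mem_maximalIdeal_pow_add (mul_mem_maximalIdeal_pow_add hb₂' hb₄) hb₆

/-- **In residue characteristic `≠ 2, 3` the junk value `I₀` (Step 11) needs `π³ ∣ Δ`.** If
`24 ∉ 𝔪`, `π ∣ Δ`, `π ∣ c₄` and `kodairaSymbolOfMinimal V = I₀`, then the tests of steps 1, 2 and
3 of Tate's algorithm failed; the step-2 translation exists (`exists_variableChange_step2`), so
on the translated model `π ∣ b₂, a₃, a₄` and `π² ∣ a₆`, whence `π³ ∣ Δ`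
(`Δ_mem_maximalIdeal_pow_three`; `Δ` is invariant under `u = 1` changes of variables).
Silverman ATAEC IV.9.4, steps 2–3. [cite: Silverman1994, IV.9.4 steps 2–3] -/
theorem Δ_mem_maximalIdeal_pow_three_of_kodairaSymbolOfMinimal_eq_I_zero {V : WeierstrassCurve R}
    (h24 : (24 : R) ∉ IsLocalRing.maximalIdeal R) (hΔ : V.Δ ∈ IsLocalRing.maximalIdeal R)
    (hc₄ : V.c₄ ∈ IsLocalRing.maximalIdeal R) (h : V.kodairaSymbolOfMinimal = .I 0) :
    V.Δ ∈ IsLocalRing.maximalIdeal R ^ 3 := by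
  have E2 := exists_variableChange_step2 V hΔ h24
  have e2 : normalizeStep2 V = E2.choose • V := by unfold normalizeStep2; rw [dif_pos E2]
  obtain ⟨hu, h3, h4, -⟩ := E2.choose_spec
  have hb₂ : (normalizeStep2 V).b₂ ∈ IsLocalRing.maximalIdeal R := by
    by_contra hb
    exact ((b₂_normalizeStep2_notMem_iff V hΔ).mp hb) hc₄
  -- the test of step 3 must have failed
  have h6 : (normalizeStep2 V).a₆ ∈ IsLocalRing.maximalIdeal R ^ 2 := by
    by_contra h6
    unfold WeierstrassCurve.kodairaSymbolOfMinimal at h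
    dsimp only at h
    rw [if_neg (not_not_intro hΔ), if_neg (not_not_intro hb₂), if_pos h6] at h
    exact KodairaSymbol.noConfusion h
  have hΔ' : V.Δ = (normalizeStep2 V).Δ := by
    rw [e2, WeierstrassCurve.variableChange_Δ, hu]; simp
  rw [hΔ']
  rw [e2] at hb₂ h6 ⊢
  exact Δ_mem_maximalIdeal_pow_three hb₂ h3 h4 h6

/-- If `a ∈ 𝔪ⁿ` and `a ≠ 0` then `n ≤ ord a` (as natural numbers, `ord = (addVal R a).toNat`).
[folklore] -/
theorem le_toNat_addVal_of_mem_pow {a : R} {n : ℕ} (ha : a ≠ 0)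
    (h : a ∈ IsLocalRing.maximalIdeal R ^ n) :
    n ≤ (IsDiscreteValuationRing.addVal R a).toNat := by
  have h' : (n : ℕ∞) ≤ IsDiscreteValuationRing.addVal R a :=
    pow_dvd_iff_le_addVal.mp (mem_maximalIdeal_pow_iff_dvd.mp h)
  have htop : IsDiscreteValuationRing.addVal R a ≠ ⊤ :=
    fun htop => ha (IsDiscreteValuationRing.addVal_eq_top_iff.mp htop)
  rw [← ENat.coe_toNat htop] at h'
  exact_mod_cast h'

/-- If `a ∈ 𝔪` and `a ≠ 0` then `ord a = (addVal R a).toNat ≠ 0`. [folklore] -/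
theorem toNat_addVal_ne_zero {a : R} (ha : a ≠ 0) (h : a ∈ IsLocalRing.maximalIdeal R) :
    (IsDiscreteValuationRing.addVal R a).toNat ≠ 0 := by
  have := le_toNat_addVal_of_mem_pow (n := 1) ha (by rwa [pow_one])
  omega

end DVR

end TateAlgorithm

end Literature.NumberTheory.DiophantineGeometry

namespace WeierstrassCurve

open Literature.NumberTheory.DiophantineGeometry Literature.NumberTheory.DiophantineGeometry.TateAlgorithm

section Local

variable {A : Type*} [CommRing A] [IsDedekindDomain A] {K : Type*} [Field K]
  [Algebra A K] [IsFractionRing A K] (v : HeightOneSpectrum A) (W : WeierstrassCurve K)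

/-- In residue characteristic `≠ 2, 3` (i.e. `ringChar (A ⧸ 𝔭ᵥ) ≠ 2, 3`), `24 = 2³ · 3` is a
unit of `O_v` (`IsDedekindDomain.HeightOneSpectrum.isUnit_two_adicCompletionIntegers`,
`isUnit_three_adicCompletionIntegers`), i.e. `24 ∉ 𝔪 (O_v)` — the hypothesis under which the
step-2 translation of Tate's algorithm exists over any residue field
(`exists_variableChange_step2`). [folklore] -/
theorem twentyfour_notMem_maximalIdeal (h2 : ringChar (A ⧸ v.asIdeal) ≠ 2)
    (h3 : ringChar (A ⧸ v.asIdeal) ≠ 3) :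
    (24 : v.adicCompletionIntegers K) ∉ IsLocalRing.maximalIdeal (v.adicCompletionIntegers K) := by
  have hu2 := HeightOneSpectrum.isUnit_two_adicCompletionIntegers K v h2
  have hu3 := HeightOneSpectrum.isUnit_three_adicCompletionIntegers K v h3
  have h24 : (24 : v.adicCompletionIntegers K) = 2 ^ 3 * 3 := by norm_num
  rw [h24]
  exact IsLocalRing.notMem_maximalIdeal.mpr ((hu2.pow 3).mul hu3)

/-- **`f_v = ε_v` in residue characteristic `≠ 2, 3`, from Ogg's formula in the additive case.**
Reduction of the named fact `WeierstrassCurve.conductorExponent_eq_tameConductorExponent`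
(Silverman ATAEC IV.10.2(b): for `p ≥ 5`, `δ = 0` and `f = 0, 1, 2` for good, multiplicative,
additive reduction) to the named fact
`WeierstrassCurve.ordMinimalDiscriminant_eq_numComponentsAt_add_one` (Table 4.1's row
`v (Δ) = m + 1` for the additive types in residue characteristic `≠ 2, 3`), following the proof
of Ogg's formula IV.11.1 for `p ≥ 5` (ATAEC p. 366): good reduction — Step 1 gives `I₀`,
`ord_v (Δ_min) = 0`, `m = 1`; multiplicative — Step 2 gives `Iₙ`, `n = ord_v (Δ_min) = m`
(`kodairaSymbolOfMinimal_eq_I_iff`); additive — `ord_v (Δ_min) = m + 1` (hypothesis `hOgg`)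
and the symbol is of additive type: it is not `Iₙ`, `n ≥ 1` (that needs `π ∤ c₄`), nor the
junk `I₀` of Step 11, which in residue characteristic `≠ 2, 3` would force `π³ ∣ Δ`
(`Δ_mem_maximalIdeal_pow_three_of_kodairaSymbolOfMinimal_eq_I_zero`) whereas `hOgg` gives
`ord_v (Δ_min) = 2`. [cite: Silverman1994, IV.10.2(b) and IV.11.1 (proof for p ≥ 5, p. 366)] -/
theorem conductorExponent_eq_tameConductorExponent_of
    (hOgg : ordMinimalDiscriminant_eq_numComponentsAt_add_one v W) :
    conductorExponent_eq_tameConductorExponent v W := by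
  intro hE h2 h3
  have h24 := twentyfour_notMem_maximalIdeal (K := K) v h2 h3
  have hΔ0 := localMinimalIntegralModel_Δ_ne_zero v W
  have hord : W.ordMinimalDiscriminant v =
      (IsDiscreteValuationRing.addVal (v.adicCompletionIntegers K)
        (W.localMinimalIntegralModel v).Δ).toNat := rfl
  unfold conductorExponent numComponentsAt
  rw [kodairaSymbolAt_def]
  by_cases hΔ : (W.localMinimalIntegralModel v).Δ ∈
      IsLocalRing.maximalIdeal (v.adicCompletionIntegers K)
  · by_cases hc₄ : (W.localMinimalIntegralModel v).c₄ ∈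
        IsLocalRing.maximalIdeal (v.adicCompletionIntegers K)
    · -- additive reduction
      have hadd : W.HasAdditiveReductionAt v :=
        (hasAdditiveReductionAt_iff_mem v W).mpr ⟨hΔ, hc₄⟩
      have key : W.ordMinimalDiscriminant v = W.numComponentsAt v + 1 := hOgg hadd h2 h3
      unfold numComponentsAt at key
      rw [kodairaSymbolAt_def] at key
      have htame : (W.localMinimalIntegralModel v).kodairaSymbolOfMinimal.tameConductorExponent
          = 2 := by
        rw [KodairaSymbol.tameConductorExponent_eq_two_iff]
        refine ⟨fun hI0 => ?_, ?_⟩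
        · -- not the junk `I₀`
          have h3le : 3 ≤ W.ordMinimalDiscriminant v :=
            hord ▸ le_toNat_addVal_of_mem_pow hΔ0
              (Δ_mem_maximalIdeal_pow_three_of_kodairaSymbolOfMinimal_eq_I_zero h24 hΔ hc₄ hI0)
          rw [KodairaSymbol.IsGood] at hI0
          rw [hI0, KodairaSymbol.numComponents_I_zero] at key
          omega
        · -- not multiplicative
          rintro ⟨n, hn, hIn⟩
          exact ((kodairaSymbolOfMinimal_eq_I_iff _ hn).mp hIn).2.1 hc₄
      rw [htame, key]
      omega
    · -- multiplicative reduction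
      have hn : W.ordMinimalDiscriminant v ≠ 0 := hord ▸ toNat_addVal_ne_zero hΔ0 hΔ
      have hI : (W.localMinimalIntegralModel v).kodairaSymbolOfMinimal =
          .I (W.ordMinimalDiscriminant v) :=
        (kodairaSymbolOfMinimal_eq_I_iff _ hn).mpr ⟨hΔ, hc₄, hord.symm⟩
      rw [hI, KodairaSymbol.numComponents_I_of_ne_zero hn,
        (KodairaSymbol.tameConductorExponent_eq_one_iff _).mpr ⟨_, hn, rfl⟩]
      omega
  · -- good reduction
    have hI : (W.localMinimalIntegralModel v).kodairaSymbolOfMinimal = .I 0 := by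
      unfold kodairaSymbolOfMinimal
      dsimp only
      rw [if_pos hΔ]
    have h0 : W.ordMinimalDiscriminant v = 0 := by
      rw [hord, IsDiscreteValuationRing.addVal_eq_zero_iff.mpr
        (IsLocalRing.notMem_maximalIdeal.mp hΔ)]
      rfl
    rw [hI, h0]
    rfl

/-- **Discharge of `WeierstrassCurve.conductorExponent_eq_tameConductorExponent`** (Silverman
ATAEC IV.10.2(b): if the residue characteristic is `p ≥ 5` then `δ (E/K) = 0` and
`f (E/K) = 0, 1, 2` according as `E` has good, multiplicative, additive reduction; whence
`f (E/K) ≤ 2`, IV.10.4 and the paragraph preceding it, p. 362). With `f_v` *defined* by Ogg's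
formula IV.11.1, the content is the `p ≥ 5` part of the proof of IV.11.1 (PDF p. 366): Table 4.1's
row `v (Δ) = m + 1` for the additive types, i.e. the discharged named fact
`WeierstrassCurve.ordMinimalDiscriminant_eq_numComponentsAt_add_one`
(`ordMinimalDiscriminant_eq_numComponentsAt_add_one_holds`, from the DVR theorem
`Literature.NumberTheory.DiophantineGeometry.TateAlgorithm.addVal_Δ_toNat_eq_numComponents_add_one` on the integral local minimal model
over `O_v`), fed into the reduction `conductorExponent_eq_tameConductorExponent_of` (Steps 1–2 for
good and multiplicative reduction, exclusion of the junk `I₀`).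
[cite: Silverman1994, IV.10.2(b) and IV.10.4; IV.11.1 (proof for p ≥ 5, p. 366) with IV.9.4 Table 4.1] -/
theorem conductorExponent_eq_tameConductorExponent_holds :
    conductorExponent_eq_tameConductorExponent v W :=
  conductorExponent_eq_tameConductorExponent_of v W
    (ordMinimalDiscriminant_eq_numComponentsAt_add_one_holds v W)

end Local

end WeierstrassCurve
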